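import Mathlib
import Summits.Ventures.PercRepro2.Defs
import Summits.Ventures.PercRepro2.Harris
import Summits.Ventures.PercRepro2.CoinDefs
import Summits.Ventures.PercRepro2.CoinInduced
import Summits.Ventures.PercRepro2.CoinLsmCoreDefs
import Summits.Ventures.PercRepro2.CoinLsmCoreU
import Summits.Ventures.PercRepro2.CoinOrTailKDefs
import Summits.Ventures.PercRepro2.CoinTreeCore
import Summits.Ventures.PercRepro2.CoinKSureTailSums
import Summits.Ventures.PercRepro2.CoinSubdivide
import Summits.Ventures.PercRepro2.CoinKSureSubOrTail
import Summits.Ventures.PercRepro2.CoinKSureSubLsm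
import Summits.Ventures.PercRepro2.CoinKSureSubGen
import Summits.Ventures.PercRepro2.CoinKSureMarkerBCoins
import Summits.Ventures.PercRepro2.CoinKSureMarkerBB2

/-!
# The markers at two OR-vertices of the head, ARBITRARY coins (blind cell PercRepro2,
night-2 g16; proofs/NIGHT2-DARC.md §56.20)

The `(b, b′)` entry of the marker table with arbitrary entry coins on all three OR-vertices, by
three subdivisions (§52/§54): the coins of `b′` (`darc_of_orTailK_markerBB'_b'coins`, from the
sure theorem `darc_of_orTailKSure_markerBB'`), then those of `b`
(`darc_of_orTailK_markerBB'_bcoins`), then those of `a` (`darc_of_orTailK_markerBB'_coins`);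
`darc_of_orTailTreeK_markerBB'_coins` the out-tree corollary.
-/

namespace Summit.Ventures.PercRepro2.Coin

open Classical

section MarkerBB2Coins

variable {V : Type*} {E : Type*} [Fintype V] [DecidableEq V] [Fintype E] [DecidableEq E]
  {R : Type*} [Field R] [LinearOrder R] [IsStrictOrderedRing R]
  {arcs : E → Finset (V × V)} {s : V} {U : Finset V} {ent : Finset V} {c : V → E} {a w : V}
  {entb : Finset V} {d : V → E} {b : V} {entb' : Finset V} {d' : V → E} {b' : V}

omit [Fintype V] [DecidableEq V] [Fintype E] in
/-- Two OR-tails with different tails have disjoint coins. -/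
lemma orTailK_coins_disjoint {U₁ U₂ ent₁ ent₂ : Finset V} {c₁ c₂ : V → E} {a₁ a₂ : V}
    (h₁ : OrTailK arcs s U₁ ent₁ c₁ a₁) (h₂ : OrTailK arcs s U₂ ent₂ c₂ a₂) (hne : a₁ ≠ a₂) :
    ∀ r ∈ ent₁, c₁ r ∉ ent₂.image c₂ := by
  intro r hr hmem
  obtain ⟨q, hq, hqr⟩ := Finset.mem_image.1 hmem
  have h1 := h₁.arcs_c r hr
  have h2 := h₂.arcs_c q hq
  rw [hqr] at h2
  rw [h1] at h2
  have : (r, a₁) ∈ ({(q, a₂)} : Finset (V × V)) := by rw [← h2]; exact Finset.mem_singleton_self _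
  rw [Finset.mem_singleton, Prod.mk.injEq] at this
  exact hne this.2

omit [Fintype V] [Fintype E] in
/-- Membership of `Sum.inl x` in the three-fold extended core. -/
lemma inl_mem_three {S₀ : Finset E} {x : V} :
    Sum.inl x ∈ insert (Sum.inl b') (insert (Sum.inl b) (insert (Sum.inl a) (subCore U S₀))) ↔
      x ∈ insert b' (insert b (insert a U)) := by
  simp only [Finset.mem_insert, inl_mem_subCore, Sum.inl.injEq]

/-- **Sure `a`- and `b`-coins, ARBITRARY `b′`-coins** (subdivide the entry coins of `b′`). -/
theorem darc_of_orTailK_markerBB'_b'coins (pr : E → R) (hp : IsProbVec pr) (hS : SameEnds arcs)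
    (h : OrTailK arcs s U ent c a) (hb : OrTailK arcs s (insert a U) entb d b) (hae : a ∉ entb)
    (hb' : OrTailK arcs s (insert b (insert a U)) entb' d' b') (hae' : a ∉ entb') (hbe' : b ∉ entb')
    (hsure : ∀ r ∈ ent, pr (c r) = 1) (hsureb : ∀ r ∈ entb, pr (d r) = 1)
    (hν : ∀ W W', W ⊆ U → W' ⊆ U →
      prob pr (coreLevel arcs s U W) * prob pr (coreLevel arcs s U W') ≤
        prob pr (coreLevel arcs s U (W ∩ W')) * prob pr (coreLevel arcs s U (W ∪ W')))
    {t : V} (htC : t ∉ insert b' (insert b (insert a U))) (hts : t ≠ s) (hws : w ≠ s)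
    (hwC : w ∉ insert b' (insert b (insert a U))) :
    DARC pr arcs s {t} b' b a w := by
  have hba : b ≠ a := fun e => hb.a_notin (e ▸ Finset.mem_insert_self a U)
  have hb'a : b' ≠ a := by
    intro e; apply hb'.a_notin; rw [e]; exact Finset.mem_insert_of_mem (Finset.mem_insert_self a U)
  have hb'b : b' ≠ b := by
    intro e; apply hb'.a_notin; rw [e]; exact Finset.mem_insert_self b _
  have hb'U : b' ∉ U := fun hU =>
    hb'.a_notin (Finset.mem_insert_of_mem (Finset.mem_insert_of_mem hU))
  have hent'U : entb' ⊆ U := by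
    intro r hr
    have := hb'.ent_sub hr
    rw [Finset.mem_insert, Finset.mem_insert] at this
    rcases this with rfl | rfl | h'
    · exact absurd hr hbe'
    · exact absurd hr hae'
    · exact h'
  have hSb' := hb'.arcs_entry
  have hsrc : ∀ e ∈ entb'.image d', srcOf entb' d' s e ∈ U := fun e he => hent'U (hb'.srcOf_mem he)
  have htgt : ∀ e ∈ entb'.image d', (fun _ => b') e ∉ U := fun _ _ => hb'U
  have htgts : ∀ e ∈ entb'.image d', (fun _ => b') e ≠ s := fun _ _ => hb'.a_ne_s
  have htgta : ∀ e ∈ entb'.image d', (fun _ => b') e ≠ a := fun _ _ => hb'a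
  have htgtb : ∀ e ∈ entb'.image d', (fun _ => b') e ≠ b := fun _ _ => hb'b
  have hU : ClosedInCoreU arcs s U := ⟨h.into_U, h.into_s, h.s_notin⟩
  -- the three OR-tails of the subdivided system
  have h₁ := orTailK_sub_untouched (S := entb'.image d') (src := srcOf entb' d' s) (tgt := fun _ => b')
    h hsrc htgt htgts htgta (orTailK_coins_disjoint h hb' hb'a.symm)
  have hsrc₂ : ∀ e ∈ entb'.image d', srcOf entb' d' s e ∈ insert a U :=
    fun e he => Finset.mem_insert_of_mem (hsrc e he)
  have hb₁ := orTailK_sub_untouched' (S := entb'.image d') (src := srcOf entb' d' s)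
    (tgt := fun _ => b') hb hsrc₂ htgts htgtb (orTailK_coins_disjoint hb hb' hb'b.symm)
  rw [subCore_insert_left] at hb₁
  have hb'₁ := orTailK_sub hb'
  rw [subCore_insert_left, subCore_insert_left] at hb'₁
  have hae₁ : (Sum.inl a : V ⊕ E) ∉ entb.map (Function.Embedding.inl : V ↪ V ⊕ E) := by
    intro hmem
    obtain ⟨q, hq, hqa⟩ := Finset.mem_map.1 hmem
    exact hae ((Sum.inl_injective hqa) ▸ hq)
  have hae'₁ : Sum.inl a ∉ (entb'.image d').map Function.Embedding.inr := by
    intro hmem; obtain ⟨e, _, he⟩ := Finset.mem_map.1 hmem; exact Sum.inr_ne_inl he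
  have hbe'₁ : Sum.inl b ∉ (entb'.image d').map Function.Embedding.inr := by
    intro hmem; obtain ⟨e, _, he⟩ := Finset.mem_map.1 hmem; exact Sum.inr_ne_inl he
  have hsure₁ : ∀ r ∈ ent.map Function.Embedding.inl,
      subPr pr ((Sum.elim (fun v => Sum.inl (c v)) (fun e => Sum.inr e) : V ⊕ E → E ⊕ E) r) = 1 := by
    intro r hr
    obtain ⟨r₀, hr₀, rfl⟩ := Finset.mem_map.1 hr
    exact hsure r₀ hr₀
  have hsureb₁ : ∀ r ∈ entb.map Function.Embedding.inl,
      subPr pr ((Sum.elim (fun v => Sum.inl (d v)) (fun e => Sum.inr e) : V ⊕ E → E ⊕ E) r) = 1 := by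
    intro r hr
    obtain ⟨r₀, hr₀, rfl⟩ := Finset.mem_map.1 hr
    exact hsureb r₀ hr₀
  have hsureb'₁ : ∀ r ∈ (entb'.image d').map Function.Embedding.inr,
      subPr pr ((Sum.elim (fun v => Sum.inl (d' v)) (fun e => Sum.inr e) : V ⊕ E → E ⊕ E) r) = 1 := by
    intro r hr
    obtain ⟨e, _, rfl⟩ := Finset.mem_map.1 hr
    rfl
  have hν₁ := subCore_lsm_gen pr hp hU hSb' hsrc htgt htgts hν (entb'.image d') (Finset.Subset.refl _)
  simp only [subLawS] at hν₁
  have htC₁ : Sum.inl t ∉ insert (Sum.inl b') (insert (Sum.inl b) (insert (Sum.inl a)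
      (subCore U (entb'.image d')))) := by rw [inl_mem_three]; exact htC
  have hwC₁ : Sum.inl w ∉ insert (Sum.inl b') (insert (Sum.inl b) (insert (Sum.inl a)
      (subCore U (entb'.image d')))) := by rw [inl_mem_three]; exact hwC
  have key := darc_of_orTailKSure_markerBB' (subPr pr) (isProbVec_subPr hp) (sameEnds_sub hS) h₁ hb₁
    hae₁ hb'₁ hae'₁ hbe'₁ hsure₁ hsureb₁ hsureb'₁ (fun W W' hW hW' => hν₁ W hW W' hW') htC₁
    (fun e => hts (Sum.inl_injective e)) (fun e => hws (Sum.inl_injective e)) hwC₁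
  have hiff := darc_sub_iff hSb' pr s {t} b' b a w
  rw [Finset.map_singleton] at hiff
  exact hiff.1 key

/-- **Sure `a`-coins, ARBITRARY `b`- and `b′`-coins** (subdivide the entry coins of `b`). -/
theorem darc_of_orTailK_markerBB'_bcoins (pr : E → R) (hp : IsProbVec pr) (hS : SameEnds arcs)
    (h : OrTailK arcs s U ent c a) (hb : OrTailK arcs s (insert a U) entb d b) (hae : a ∉ entb)
    (hb' : OrTailK arcs s (insert b (insert a U)) entb' d' b') (hae' : a ∉ entb') (hbe' : b ∉ entb')
    (hsure : ∀ r ∈ ent, pr (c r) = 1)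
    (hν : ∀ W W', W ⊆ U → W' ⊆ U →
      prob pr (coreLevel arcs s U W) * prob pr (coreLevel arcs s U W') ≤
        prob pr (coreLevel arcs s U (W ∩ W')) * prob pr (coreLevel arcs s U (W ∪ W')))
    {t : V} (htC : t ∉ insert b' (insert b (insert a U))) (hts : t ≠ s) (hws : w ≠ s)
    (hwC : w ∉ insert b' (insert b (insert a U))) :
    DARC pr arcs s {t} b' b a w := by
  have hba : b ≠ a := fun e => hb.a_notin (e ▸ Finset.mem_insert_self a U)
  have hbU : b ∉ U := fun hbU => hb.a_notin (Finset.mem_insert_of_mem hbU)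
  have hb'b : b' ≠ b := by
    intro e; apply hb'.a_notin; rw [e]; exact Finset.mem_insert_self b _
  have hentU : entb ⊆ U := by
    intro r hr
    have := hb.ent_sub hr
    rw [Finset.mem_insert] at this
    rcases this with rfl | h'
    · exact absurd hr hae
    · exact h'
  have hSb := hb.arcs_entry
  have hsrc : ∀ e ∈ entb.image d, srcOf entb d s e ∈ U := fun e he => hentU (hb.srcOf_mem he)
  have htgt : ∀ e ∈ entb.image d, (fun _ => b) e ∉ U := fun _ _ => hbU
  have htgts : ∀ e ∈ entb.image d, (fun _ => b) e ≠ s := fun _ _ => hb.a_ne_s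
  have htgta : ∀ e ∈ entb.image d, (fun _ => b) e ≠ a := fun _ _ => hba
  have htgtb' : ∀ e ∈ entb.image d, (fun _ => b) e ≠ b' := fun _ _ => hb'b.symm
  have hU : ClosedInCoreU arcs s U := ⟨h.into_U, h.into_s, h.s_notin⟩
  have h₁ := orTailK_sub_untouched (S := entb.image d) (src := srcOf entb d s) (tgt := fun _ => b)
    h hsrc htgt htgts htgta (orTailK_coins_disjoint h hb hba.symm)
  have hb₁ := orTailK_sub hb
  rw [subCore_insert_left] at hb₁
  have hsrc₂ : ∀ e ∈ entb.image d, srcOf entb d s e ∈ insert b (insert a U) :=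
    fun e he => Finset.mem_insert_of_mem (Finset.mem_insert_of_mem (hsrc e he))
  have hb'₁ := orTailK_sub_untouched' (S := entb.image d) (src := srcOf entb d s) (tgt := fun _ => b)
    hb' hsrc₂ htgts htgtb' (orTailK_coins_disjoint hb' hb hb'b)
  rw [subCore_insert_left, subCore_insert_left] at hb'₁
  have hae₁ : Sum.inl a ∉ (entb.image d).map Function.Embedding.inr := by
    intro hmem; obtain ⟨e, _, he⟩ := Finset.mem_map.1 hmem; exact Sum.inr_ne_inl he
  have hae'₁ : (Sum.inl a : V ⊕ E) ∉ entb'.map (Function.Embedding.inl : V ↪ V ⊕ E) := by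
    intro hmem
    obtain ⟨q, hq, hqa⟩ := Finset.mem_map.1 hmem
    exact hae' ((Sum.inl_injective hqa) ▸ hq)
  have hbe'₁ : (Sum.inl b : V ⊕ E) ∉ entb'.map (Function.Embedding.inl : V ↪ V ⊕ E) := by
    intro hmem
    obtain ⟨q, hq, hqb⟩ := Finset.mem_map.1 hmem
    exact hbe' ((Sum.inl_injective hqb) ▸ hq)
  have hsure₁ : ∀ r ∈ ent.map Function.Embedding.inl,
      subPr pr ((Sum.elim (fun v => Sum.inl (c v)) (fun e => Sum.inr e) : V ⊕ E → E ⊕ E) r) = 1 := by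
    intro r hr
    obtain ⟨r₀, hr₀, rfl⟩ := Finset.mem_map.1 hr
    exact hsure r₀ hr₀
  have hsureb₁ : ∀ r ∈ (entb.image d).map Function.Embedding.inr,
      subPr pr ((Sum.elim (fun v => Sum.inl (d v)) (fun e => Sum.inr e) : V ⊕ E → E ⊕ E) r) = 1 := by
    intro r hr
    obtain ⟨e, _, rfl⟩ := Finset.mem_map.1 hr
    rfl
  have hν₁ := subCore_lsm_gen pr hp hU hSb hsrc htgt htgts hν (entb.image d) (Finset.Subset.refl _)
  simp only [subLawS] at hν₁
  have htC₁ : Sum.inl t ∉ insert (Sum.inl b') (insert (Sum.inl b) (insert (Sum.inl a)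
      (subCore U (entb.image d)))) := by rw [inl_mem_three]; exact htC
  have hwC₁ : Sum.inl w ∉ insert (Sum.inl b') (insert (Sum.inl b) (insert (Sum.inl a)
      (subCore U (entb.image d)))) := by rw [inl_mem_three]; exact hwC
  have key := darc_of_orTailK_markerBB'_b'coins (subPr pr) (isProbVec_subPr hp) (sameEnds_sub hS)
    h₁ hb₁ hae₁ hb'₁ hae'₁ hbe'₁ hsure₁ hsureb₁ (fun W W' hW hW' => hν₁ W hW W' hW') htC₁
    (fun e => hts (Sum.inl_injective e)) (fun e => hws (Sum.inl_injective e)) hwC₁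
  have hiff := darc_sub_iff hSb pr s {t} b' b a w
  rw [Finset.map_singleton] at hiff
  exact hiff.1 key

/-- **THEOREM (markers at two OR-vertices `b′, b` of the head, ARBITRARY coins everywhere).** -/
theorem darc_of_orTailK_markerBB'_coins (pr : E → R) (hp : IsProbVec pr) (hS : SameEnds arcs)
    (h : OrTailK arcs s U ent c a) (hb : OrTailK arcs s (insert a U) entb d b) (hae : a ∉ entb)
    (hb' : OrTailK arcs s (insert b (insert a U)) entb' d' b') (hae' : a ∉ entb') (hbe' : b ∉ entb')
    (hν : ∀ W W', W ⊆ U → W' ⊆ U →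
      prob pr (coreLevel arcs s U W) * prob pr (coreLevel arcs s U W') ≤
        prob pr (coreLevel arcs s U (W ∩ W')) * prob pr (coreLevel arcs s U (W ∪ W')))
    {t : V} (htC : t ∉ insert b' (insert b (insert a U))) (hts : t ≠ s) (hws : w ≠ s)
    (hwC : w ∉ insert b' (insert b (insert a U))) :
    DARC pr arcs s {t} b' b a w := by
  have hba : b ≠ a := fun e => hb.a_notin (e ▸ Finset.mem_insert_self a U)
  have hb'a : b' ≠ a := by
    intro e; apply hb'.a_notin; rw [e]; exact Finset.mem_insert_of_mem (Finset.mem_insert_self a U)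
  have hSa := h.arcs_entry
  have h₁ := orTailK_sub h
  have hsrc₁ : ∀ e ∈ ent.image c, srcOf ent c s e ∈ insert a U :=
    fun e he => Finset.mem_insert_of_mem (h.ent_sub (h.srcOf_mem he))
  have hsrc₂ : ∀ e ∈ ent.image c, srcOf ent c s e ∈ insert b (insert a U) :=
    fun e he => Finset.mem_insert_of_mem (hsrc₁ e he)
  have htgts₁ : ∀ e ∈ ent.image c, (fun _ => a) e ≠ s := fun _ _ => h.a_ne_s
  have htgtb : ∀ e ∈ ent.image c, (fun _ => a) e ≠ b := fun _ _ => hba.symm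
  have htgtb' : ∀ e ∈ ent.image c, (fun _ => a) e ≠ b' := fun _ _ => hb'a.symm
  have hb₁ := orTailK_sub_untouched' (S := ent.image c) (src := srcOf ent c s) (tgt := fun _ => a)
    hb hsrc₁ htgts₁ htgtb (orTailK_coins_disjoint hb h hba)
  rw [subCore_insert_left] at hb₁
  have hb'₁ := orTailK_sub_untouched' (S := ent.image c) (src := srcOf ent c s) (tgt := fun _ => a)
    hb' hsrc₂ htgts₁ htgtb' (orTailK_coins_disjoint hb' h hb'a)
  rw [subCore_insert_left, subCore_insert_left] at hb'₁
  have hae₁ : (Sum.inl a : V ⊕ E) ∉ entb.map (Function.Embedding.inl : V ↪ V ⊕ E) := by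
    intro hmem
    obtain ⟨q, hq, hqa⟩ := Finset.mem_map.1 hmem
    exact hae ((Sum.inl_injective hqa) ▸ hq)
  have hae'₁ : (Sum.inl a : V ⊕ E) ∉ entb'.map (Function.Embedding.inl : V ↪ V ⊕ E) := by
    intro hmem
    obtain ⟨q, hq, hqa⟩ := Finset.mem_map.1 hmem
    exact hae' ((Sum.inl_injective hqa) ▸ hq)
  have hbe'₁ : (Sum.inl b : V ⊕ E) ∉ entb'.map (Function.Embedding.inl : V ↪ V ⊕ E) := by
    intro hmem
    obtain ⟨q, hq, hqb⟩ := Finset.mem_map.1 hmem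
    exact hbe' ((Sum.inl_injective hqb) ▸ hq)
  have hsure₁ : ∀ r ∈ (ent.image c).map Function.Embedding.inr,
      subPr pr ((Sum.elim (fun v => Sum.inl (c v)) (fun e => Sum.inr e) : V ⊕ E → E ⊕ E) r) = 1 := by
    intro r hr
    obtain ⟨e, _, rfl⟩ := Finset.mem_map.1 hr
    rfl
  have hν₁ := subCore_lsm pr hp h hν (ent.image c) (Finset.Subset.refl _)
  simp only [subLaw] at hν₁
  have htC₁ : Sum.inl t ∉ insert (Sum.inl b') (insert (Sum.inl b) (insert (Sum.inl a)
      (subCore U (ent.image c)))) := by rw [inl_mem_three]; exact htC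
  have hwC₁ : Sum.inl w ∉ insert (Sum.inl b') (insert (Sum.inl b) (insert (Sum.inl a)
      (subCore U (ent.image c)))) := by rw [inl_mem_three]; exact hwC
  have key := darc_of_orTailK_markerBB'_bcoins (subPr pr) (isProbVec_subPr hp) (sameEnds_sub hS)
    h₁ hb₁ hae₁ hb'₁ hae'₁ hbe'₁ hsure₁ (fun W W' hW hW' => hν₁ W hW W' hW') htC₁
    (fun e => hts (Sum.inl_injective e)) (fun e => hws (Sum.inl_injective e)) hwC₁
  have hiff := darc_sub_iff hSa pr s {t} b' b a w
  rw [Finset.map_singleton] at hiff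
  exact hiff.1 key

/-- **The out-tree corollary.** -/
theorem darc_of_orTailTreeK_markerBB'_coins (pr : E → R) (hp : IsProbVec pr) (hS : SameEnds arcs)
    (h : OrTailK arcs s U ent c a) (hb : OrTailK arcs s (insert a U) entb d b) (hae : a ∉ entb)
    (hb' : OrTailK arcs s (insert b (insert a U)) entb' d' b') (hae' : a ∉ entb') (hbe' : b ∉ entb')
    {c' : V → E} {par : V → V} {rk : V → ℕ} (hT : TreeCore arcs s U c' par rk)
    {t : V} (htC : t ∉ insert b' (insert b (insert a U))) (hts : t ≠ s) (hws : w ≠ s)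
    (hwC : w ∉ insert b' (insert b (insert a U))) :
    DARC pr arcs s {t} b' b a w :=
  darc_of_orTailK_markerBB'_coins pr hp hS h hb hae hb' hae' hbe' (hT.coreLevel_lsm pr hp) htC hts
    hws hwC

end MarkerBB2Coins

end Summit.Ventures.PercRepro2.Coin
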